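import Mathlib
import Summits.Ventures.PercRepro2.HCov
import Summits.Ventures.PercRepro2.GcTransport
import Summits.Ventures.PercRepro2.RootLeafUStarMerge
import Summits.Ventures.PercRepro2.RootLeafUCoin3Pin

/-!
# The mass table of the 3-coin class `N(b) = {a₂, u, c}`, part A: the six `o`-free masses `Z, D, t, t′, hb, d0`
(blind cell PercRepro2, p4 g17; S3 (G4-u) item (ad), proofs/P4-G17-COIN3.md)

`b` carries exactly the three coins `f₁ = {b, a₂}`, `f₂ = {b, u}`, `f₃ = {b, c}`.  Pinning the coins
(`prob_three_coins`) and the coin-world connectivity of RootLeafUStarMerge express each mass of the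
instance `(o, u, a₂, c, b)` as a coin polynomial in masses of the outside instance under the pinned
weights `p⁰ = p[f₃ ↦ 0][f₂ ↦ 0][f₁ ↦ 0]`.  Each world is one `ext; simp only [...]` with the star
lemmas; no definitions, every world event written out.
-/

namespace Summit.Ventures.PercRepro2

open UnionCluster CovForm

namespace RootLeafU

namespace Coin3

variable {V : Type*} {E : Type*} [Fintype E] [DecidableEq E] {R : Type*} [CommRing R]

/-- Table entry `Z`: `P(avoidAll ends a₂ {u})` in the coin worlds. -/
theorem table_Z (p : E → R) (ends : E → Sym2 V) (u a₂ c b : V) (f₁ f₂ f₃ : E)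
    (hf₁ : ends f₁ = s(b, a₂)) (hf₂ : ends f₂ = s(b, u)) (hf₃ : ends f₃ = s(b, c))
    (hstar : ∀ e, (∃ y, ends e = s(b, y)) → e = f₁ ∨ e = f₂ ∨ e = f₃)
    (h12 : f₁ ≠ f₂) (h13 : f₁ ≠ f₃) (h23 : f₂ ≠ f₃) (hub : u ≠ b) (ha2b : a₂ ≠ b) :
    prob p (avoidAll ends a₂ {u}) =
      p f₁ * (1 - p f₂) * p f₃ * prob (Function.update (Function.update (Function.update p f₃ 0) f₂ 0) f₁ 0) (avoidAll ends a₂ {u} ∩ (connEvent ends u c)ᶜ) +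
      p f₁ * (1 - p f₂) * (1 - p f₃) * prob (Function.update (Function.update (Function.update p f₃ 0) f₂ 0) f₁ 0) (avoidAll ends a₂ {u}) +
      (1 - p f₁) * p f₂ * p f₃ * prob (Function.update (Function.update (Function.update p f₃ 0) f₂ 0) f₁ 0) (avoidAll ends a₂ {u} ∩ (connEvent ends a₂ c)ᶜ) +
      (1 - p f₁) * p f₂ * (1 - p f₃) * prob (Function.update (Function.update (Function.update p f₃ 0) f₂ 0) f₁ 0) (avoidAll ends a₂ {u}) +
      (1 - p f₁) * (1 - p f₂) * p f₃ * prob (Function.update (Function.update (Function.update p f₃ 0) f₂ 0) f₁ 0) (avoidAll ends a₂ {u}) +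
      (1 - p f₁) * (1 - p f₂) * (1 - p f₃) * prob (Function.update (Function.update (Function.update p f₃ 0) f₂ 0) f₁ 0) (avoidAll ends a₂ {u}) := by
  have hsymm : ∀ (ω : Config E) (v w : V), Conn ends ω v w ↔ Conn ends ω w v :=
    fun ω v w => ⟨conn_symm, conn_symm⟩
  rw [prob_three_coins p _ f₁ f₂ f₃]
  have e111 : {ω : Config E | Function.update (Function.update (Function.update ω f₃ true) f₂ true) f₁ true ∈ avoidAll ends a₂ {u}} = ∅ := by
    ext ω
    simp only [Set.mem_setOf_eq, mem_avoidAll, Finset.mem_singleton, forall_eq, Set.mem_empty_iff_false, Merge.conn_star_iff hf₁ hf₂ hf₃ hstar h12 h13 h23 ω true true true, hub, ha2b, ne_eq, not_false_eq_true, conn_refl, true_and, and_true, true_or, or_true, not_true_eq_false, not_false_eq_true, hsymm]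
  have e110 : {ω : Config E | Function.update (Function.update (Function.update ω f₃ false) f₂ true) f₁ true ∈ avoidAll ends a₂ {u}} = ∅ := by
    ext ω
    simp only [Set.mem_setOf_eq, mem_avoidAll, Finset.mem_singleton, forall_eq, Set.mem_empty_iff_false, Merge.conn_star_iff hf₁ hf₂ hf₃ hstar h12 h13 h23 ω true true false, hub, ha2b, ne_eq, not_false_eq_true, conn_refl, true_and, false_and, and_true, or_false, true_or, or_true, Bool.false_eq_true, not_true_eq_false, not_false_eq_true, hsymm]
  have e101 : {ω : Config E | Function.update (Function.update (Function.update ω f₃ true) f₂ false) f₁ true ∈ avoidAll ends a₂ {u}} = {ω : Config E | Function.update (Function.update (Function.update ω f₃ false) f₂ false) f₁ false ∈ avoidAll ends a₂ {u} ∩ (connEvent ends u c)ᶜ} := by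
    ext ω
    simp only [Set.mem_setOf_eq, Set.mem_inter_iff, Set.mem_compl_iff, mem_connEvent, mem_avoidAll, Finset.mem_singleton, forall_eq, Merge.conn_star_iff hf₁ hf₂ hf₃ hstar h12 h13 h23 ω true false true, hub, ha2b, ne_eq, not_false_eq_true, conn_refl, true_and, false_and, and_true, false_or, true_or, Bool.false_eq_true, not_false_eq_true, hsymm]
    tauto
  have e100 : {ω : Config E | Function.update (Function.update (Function.update ω f₃ false) f₂ false) f₁ true ∈ avoidAll ends a₂ {u}} = {ω : Config E | Function.update (Function.update (Function.update ω f₃ false) f₂ false) f₁ false ∈ avoidAll ends a₂ {u}} := by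
    ext ω
    simp only [Set.mem_setOf_eq, mem_avoidAll, Finset.mem_singleton, forall_eq, Merge.conn_star_100_iff hf₁ hf₂ hf₃ hstar h12 h13 h23 ω, hub, ha2b, ne_eq, not_false_eq_true, not_false_eq_true, hsymm]
  have e011 : {ω : Config E | Function.update (Function.update (Function.update ω f₃ true) f₂ true) f₁ false ∈ avoidAll ends a₂ {u}} = {ω : Config E | Function.update (Function.update (Function.update ω f₃ false) f₂ false) f₁ false ∈ avoidAll ends a₂ {u} ∩ (connEvent ends a₂ c)ᶜ} := by
    ext ω
    simp only [Set.mem_setOf_eq, Set.mem_inter_iff, Set.mem_compl_iff, mem_connEvent, mem_avoidAll, Finset.mem_singleton, forall_eq, Merge.conn_star_iff hf₁ hf₂ hf₃ hstar h12 h13 h23 ω false true true, hub, ha2b, ne_eq, not_false_eq_true, conn_refl, true_and, false_and, and_true, false_or, true_or, or_true, Bool.false_eq_true, not_false_eq_true, hsymm]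
    tauto
  have e010 : {ω : Config E | Function.update (Function.update (Function.update ω f₃ false) f₂ true) f₁ false ∈ avoidAll ends a₂ {u}} = {ω : Config E | Function.update (Function.update (Function.update ω f₃ false) f₂ false) f₁ false ∈ avoidAll ends a₂ {u}} := by
    ext ω
    simp only [Set.mem_setOf_eq, mem_avoidAll, Finset.mem_singleton, forall_eq, Merge.conn_star_010_iff hf₁ hf₂ hf₃ hstar h12 h13 h23 ω, hub, ha2b, ne_eq, not_false_eq_true, not_false_eq_true, hsymm]
  have e001 : {ω : Config E | Function.update (Function.update (Function.update ω f₃ true) f₂ false) f₁ false ∈ avoidAll ends a₂ {u}} = {ω : Config E | Function.update (Function.update (Function.update ω f₃ false) f₂ false) f₁ false ∈ avoidAll ends a₂ {u}} := by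
    ext ω
    simp only [Set.mem_setOf_eq, mem_avoidAll, Finset.mem_singleton, forall_eq, Merge.conn_star_001_iff hf₁ hf₂ hf₃ hstar h12 h13 h23 ω, hub, ha2b, ne_eq, not_false_eq_true, not_false_eq_true, hsymm]
  rw [e111, e110, e101, e100, e011, e010, e001]
  simp only [prob_empty, ← prob_pinned_eq]
  ring


/-- Table entry `D`: `P(PDEvent ends u a₂ c)` in the coin worlds. -/
theorem table_D (p : E → R) (ends : E → Sym2 V) (u a₂ c b : V) (f₁ f₂ f₃ : E)
    (hf₁ : ends f₁ = s(b, a₂)) (hf₂ : ends f₂ = s(b, u)) (hf₃ : ends f₃ = s(b, c))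
    (hstar : ∀ e, (∃ y, ends e = s(b, y)) → e = f₁ ∨ e = f₂ ∨ e = f₃)
    (h12 : f₁ ≠ f₂) (h13 : f₁ ≠ f₃) (h23 : f₂ ≠ f₃) (hub : u ≠ b) (ha2b : a₂ ≠ b) (hcb : c ≠ b) :
    prob p (PDEvent ends u a₂ c) =
      p f₁ * (1 - p f₂) * (1 - p f₃) * prob (Function.update (Function.update (Function.update p f₃ 0) f₂ 0) f₁ 0) (PDEvent ends u a₂ c) +
      (1 - p f₁) * p f₂ * (1 - p f₃) * prob (Function.update (Function.update (Function.update p f₃ 0) f₂ 0) f₁ 0) (PDEvent ends u a₂ c) +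
      (1 - p f₁) * (1 - p f₂) * p f₃ * prob (Function.update (Function.update (Function.update p f₃ 0) f₂ 0) f₁ 0) (PDEvent ends u a₂ c) +
      (1 - p f₁) * (1 - p f₂) * (1 - p f₃) * prob (Function.update (Function.update (Function.update p f₃ 0) f₂ 0) f₁ 0) (PDEvent ends u a₂ c) := by
  have hsymm : ∀ (ω : Config E) (v w : V), Conn ends ω v w ↔ Conn ends ω w v :=
    fun ω v w => ⟨conn_symm, conn_symm⟩
  rw [prob_three_coins p _ f₁ f₂ f₃]
  have e111 : {ω : Config E | Function.update (Function.update (Function.update ω f₃ true) f₂ true) f₁ true ∈ PDEvent ends u a₂ c} = ∅ := by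
    ext ω
    simp only [Set.mem_setOf_eq, Set.mem_inter_iff, Set.mem_compl_iff, mem_connEvent, PDEvent, Dtilde, UnionCluster.mem_inU, Set.mem_empty_iff_false, Merge.conn_star_iff hf₁ hf₂ hf₃ hstar h12 h13 h23 ω true true true, hub, ha2b, hcb, ne_eq, not_false_eq_true, conn_refl, true_and, and_true, and_false, true_or, or_true, not_true_eq_false, not_false_eq_true, hsymm]
  have e110 : {ω : Config E | Function.update (Function.update (Function.update ω f₃ false) f₂ true) f₁ true ∈ PDEvent ends u a₂ c} = ∅ := by
    ext ω
    simp only [Set.mem_setOf_eq, Set.mem_inter_iff, Set.mem_compl_iff, mem_connEvent, PDEvent, Dtilde, UnionCluster.mem_inU, Set.mem_empty_iff_false, Merge.conn_star_iff hf₁ hf₂ hf₃ hstar h12 h13 h23 ω true true false, hub, ha2b, hcb, ne_eq, not_false_eq_true, conn_refl, true_and, false_and, and_true, or_false, true_or, or_true, Bool.false_eq_true, not_true_eq_false, not_false_eq_true, hsymm]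
  have e101 : {ω : Config E | Function.update (Function.update (Function.update ω f₃ true) f₂ false) f₁ true ∈ PDEvent ends u a₂ c} = ∅ := by
    ext ω
    simp only [Set.mem_setOf_eq, Set.mem_inter_iff, Set.mem_compl_iff, mem_connEvent, PDEvent, Dtilde, UnionCluster.mem_inU, Set.mem_empty_iff_false, Merge.conn_star_iff hf₁ hf₂ hf₃ hstar h12 h13 h23 ω true false true, hub, ha2b, hcb, ne_eq, not_false_eq_true, conn_refl, true_and, false_and, and_true, and_false, false_or, true_or, or_true, Bool.false_eq_true, not_true_eq_false, not_false_eq_true, hsymm]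
  have e100 : {ω : Config E | Function.update (Function.update (Function.update ω f₃ false) f₂ false) f₁ true ∈ PDEvent ends u a₂ c} = {ω : Config E | Function.update (Function.update (Function.update ω f₃ false) f₂ false) f₁ false ∈ PDEvent ends u a₂ c} := by
    ext ω
    simp only [Set.mem_setOf_eq, Set.mem_inter_iff, Set.mem_compl_iff, mem_connEvent, PDEvent, Dtilde, UnionCluster.mem_inU, Merge.conn_star_100_iff hf₁ hf₂ hf₃ hstar h12 h13 h23 ω, hub, ha2b, hcb, ne_eq, not_false_eq_true, not_false_eq_true, hsymm]
  have e011 : {ω : Config E | Function.update (Function.update (Function.update ω f₃ true) f₂ true) f₁ false ∈ PDEvent ends u a₂ c} = ∅ := by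
    ext ω
    simp only [Set.mem_setOf_eq, Set.mem_inter_iff, Set.mem_compl_iff, mem_connEvent, PDEvent, Dtilde, UnionCluster.mem_inU, Set.mem_empty_iff_false, Merge.conn_star_iff hf₁ hf₂ hf₃ hstar h12 h13 h23 ω false true true, hub, ha2b, hcb, ne_eq, not_false_eq_true, conn_refl, true_and, false_and, and_true, and_false, false_or, true_or, or_true, Bool.false_eq_true, not_true_eq_false, not_false_eq_true, hsymm]
  have e010 : {ω : Config E | Function.update (Function.update (Function.update ω f₃ false) f₂ true) f₁ false ∈ PDEvent ends u a₂ c} = {ω : Config E | Function.update (Function.update (Function.update ω f₃ false) f₂ false) f₁ false ∈ PDEvent ends u a₂ c} := by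
    ext ω
    simp only [Set.mem_setOf_eq, Set.mem_inter_iff, Set.mem_compl_iff, mem_connEvent, PDEvent, Dtilde, UnionCluster.mem_inU, Merge.conn_star_010_iff hf₁ hf₂ hf₃ hstar h12 h13 h23 ω, hub, ha2b, hcb, ne_eq, not_false_eq_true, not_false_eq_true, hsymm]
  have e001 : {ω : Config E | Function.update (Function.update (Function.update ω f₃ true) f₂ false) f₁ false ∈ PDEvent ends u a₂ c} = {ω : Config E | Function.update (Function.update (Function.update ω f₃ false) f₂ false) f₁ false ∈ PDEvent ends u a₂ c} := by
    ext ω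
    simp only [Set.mem_setOf_eq, Set.mem_inter_iff, Set.mem_compl_iff, mem_connEvent, PDEvent, Dtilde, UnionCluster.mem_inU, Merge.conn_star_001_iff hf₁ hf₂ hf₃ hstar h12 h13 h23 ω, hub, ha2b, hcb, ne_eq, not_false_eq_true, not_false_eq_true, hsymm]
  rw [e111, e110, e101, e100, e011, e010, e001]
  simp only [prob_empty, ← prob_pinned_eq]
  ring


/-- Table entry `t`: `P(TEvent ends u a₂ c)` in the coin worlds. -/
theorem table_t (p : E → R) (ends : E → Sym2 V) (u a₂ c b : V) (f₁ f₂ f₃ : E)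
    (hf₁ : ends f₁ = s(b, a₂)) (hf₂ : ends f₂ = s(b, u)) (hf₃ : ends f₃ = s(b, c))
    (hstar : ∀ e, (∃ y, ends e = s(b, y)) → e = f₁ ∨ e = f₂ ∨ e = f₃)
    (h12 : f₁ ≠ f₂) (h13 : f₁ ≠ f₃) (h23 : f₂ ≠ f₃) (hub : u ≠ b) (ha2b : a₂ ≠ b) (hcb : c ≠ b) :
    prob p (TEvent ends u a₂ c) =
      p f₁ * (1 - p f₂) * p f₃ * prob (Function.update (Function.update (Function.update p f₃ 0) f₂ 0) f₁ 0) (avoidAll ends a₂ {u} ∩ (connEvent ends u c)ᶜ) +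
      p f₁ * (1 - p f₂) * (1 - p f₃) * prob (Function.update (Function.update (Function.update p f₃ 0) f₂ 0) f₁ 0) (TEvent ends u a₂ c) +
      (1 - p f₁) * p f₂ * (1 - p f₃) * prob (Function.update (Function.update (Function.update p f₃ 0) f₂ 0) f₁ 0) (TEvent ends u a₂ c) +
      (1 - p f₁) * (1 - p f₂) * p f₃ * prob (Function.update (Function.update (Function.update p f₃ 0) f₂ 0) f₁ 0) (TEvent ends u a₂ c) +
      (1 - p f₁) * (1 - p f₂) * (1 - p f₃) * prob (Function.update (Function.update (Function.update p f₃ 0) f₂ 0) f₁ 0) (TEvent ends u a₂ c) := by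
  have hsymm : ∀ (ω : Config E) (v w : V), Conn ends ω v w ↔ Conn ends ω w v :=
    fun ω v w => ⟨conn_symm, conn_symm⟩
  rw [prob_three_coins p _ f₁ f₂ f₃]
  have e111 : {ω : Config E | Function.update (Function.update (Function.update ω f₃ true) f₂ true) f₁ true ∈ TEvent ends u a₂ c} = ∅ := by
    ext ω
    simp only [Set.mem_setOf_eq, Set.mem_inter_iff, Set.mem_compl_iff, mem_connEvent, TEvent, Set.mem_empty_iff_false, Merge.conn_star_iff hf₁ hf₂ hf₃ hstar h12 h13 h23 ω true true true, hub, ha2b, hcb, ne_eq, not_false_eq_true, conn_refl, true_and, and_true, true_or, or_true, not_true_eq_false, not_false_eq_true, hsymm]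
  have e110 : {ω : Config E | Function.update (Function.update (Function.update ω f₃ false) f₂ true) f₁ true ∈ TEvent ends u a₂ c} = ∅ := by
    ext ω
    simp only [Set.mem_setOf_eq, Set.mem_inter_iff, Set.mem_compl_iff, mem_connEvent, TEvent, Set.mem_empty_iff_false, Merge.conn_star_iff hf₁ hf₂ hf₃ hstar h12 h13 h23 ω true true false, hub, ha2b, hcb, ne_eq, not_false_eq_true, conn_refl, true_and, false_and, and_true, or_false, true_or, or_true, Bool.false_eq_true, not_true_eq_false, not_false_eq_true, hsymm]
  have e101 : {ω : Config E | Function.update (Function.update (Function.update ω f₃ true) f₂ false) f₁ true ∈ TEvent ends u a₂ c} = {ω : Config E | Function.update (Function.update (Function.update ω f₃ false) f₂ false) f₁ false ∈ avoidAll ends a₂ {u} ∩ (connEvent ends u c)ᶜ} := by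
    ext ω
    simp only [Set.mem_setOf_eq, Set.mem_inter_iff, Set.mem_compl_iff, mem_connEvent, mem_avoidAll, Finset.mem_singleton, forall_eq, TEvent, Merge.conn_star_iff hf₁ hf₂ hf₃ hstar h12 h13 h23 ω true false true, hub, ha2b, hcb, ne_eq, not_false_eq_true, conn_refl, true_and, false_and, and_true, false_or, true_or, or_true, Bool.false_eq_true, not_false_eq_true, hsymm]
    tauto
  have e100 : {ω : Config E | Function.update (Function.update (Function.update ω f₃ false) f₂ false) f₁ true ∈ TEvent ends u a₂ c} = {ω : Config E | Function.update (Function.update (Function.update ω f₃ false) f₂ false) f₁ false ∈ TEvent ends u a₂ c} := by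
    ext ω
    simp only [Set.mem_setOf_eq, Set.mem_inter_iff, Set.mem_compl_iff, mem_connEvent, TEvent, Merge.conn_star_100_iff hf₁ hf₂ hf₃ hstar h12 h13 h23 ω, hub, ha2b, hcb, ne_eq, not_false_eq_true, not_false_eq_true, hsymm]
  have e011 : {ω : Config E | Function.update (Function.update (Function.update ω f₃ true) f₂ true) f₁ false ∈ TEvent ends u a₂ c} = ∅ := by
    ext ω
    simp only [Set.mem_setOf_eq, Set.mem_inter_iff, Set.mem_compl_iff, mem_connEvent, TEvent, Set.mem_empty_iff_false, Merge.conn_star_iff hf₁ hf₂ hf₃ hstar h12 h13 h23 ω false true true, hub, ha2b, hcb, ne_eq, not_false_eq_true, conn_refl, true_and, false_and, and_true, false_or, true_or, or_true, Bool.false_eq_true, not_false_eq_true, iff_false, hsymm]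
    tauto
  have e010 : {ω : Config E | Function.update (Function.update (Function.update ω f₃ false) f₂ true) f₁ false ∈ TEvent ends u a₂ c} = {ω : Config E | Function.update (Function.update (Function.update ω f₃ false) f₂ false) f₁ false ∈ TEvent ends u a₂ c} := by
    ext ω
    simp only [Set.mem_setOf_eq, Set.mem_inter_iff, Set.mem_compl_iff, mem_connEvent, TEvent, Merge.conn_star_010_iff hf₁ hf₂ hf₃ hstar h12 h13 h23 ω, hub, ha2b, hcb, ne_eq, not_false_eq_true, not_false_eq_true, hsymm]
  have e001 : {ω : Config E | Function.update (Function.update (Function.update ω f₃ true) f₂ false) f₁ false ∈ TEvent ends u a₂ c} = {ω : Config E | Function.update (Function.update (Function.update ω f₃ false) f₂ false) f₁ false ∈ TEvent ends u a₂ c} := by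
    ext ω
    simp only [Set.mem_setOf_eq, Set.mem_inter_iff, Set.mem_compl_iff, mem_connEvent, TEvent, Merge.conn_star_001_iff hf₁ hf₂ hf₃ hstar h12 h13 h23 ω, hub, ha2b, hcb, ne_eq, not_false_eq_true, not_false_eq_true, hsymm]
  rw [e111, e110, e101, e100, e011, e010, e001]
  simp only [prob_empty, ← prob_pinned_eq]
  ring


/-- Table entry `tp`: `P(TEvent ends a₂ u c)` in the coin worlds. -/
theorem table_tp (p : E → R) (ends : E → Sym2 V) (u a₂ c b : V) (f₁ f₂ f₃ : E)
    (hf₁ : ends f₁ = s(b, a₂)) (hf₂ : ends f₂ = s(b, u)) (hf₃ : ends f₃ = s(b, c))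
    (hstar : ∀ e, (∃ y, ends e = s(b, y)) → e = f₁ ∨ e = f₂ ∨ e = f₃)
    (h12 : f₁ ≠ f₂) (h13 : f₁ ≠ f₃) (h23 : f₂ ≠ f₃) (hub : u ≠ b) (ha2b : a₂ ≠ b) (hcb : c ≠ b) :
    prob p (TEvent ends a₂ u c) =
      p f₁ * (1 - p f₂) * (1 - p f₃) * prob (Function.update (Function.update (Function.update p f₃ 0) f₂ 0) f₁ 0) (TEvent ends a₂ u c) +
      (1 - p f₁) * p f₂ * p f₃ * prob (Function.update (Function.update (Function.update p f₃ 0) f₂ 0) f₁ 0) (avoidAll ends a₂ {u} ∩ (connEvent ends a₂ c)ᶜ) +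
      (1 - p f₁) * p f₂ * (1 - p f₃) * prob (Function.update (Function.update (Function.update p f₃ 0) f₂ 0) f₁ 0) (TEvent ends a₂ u c) +
      (1 - p f₁) * (1 - p f₂) * p f₃ * prob (Function.update (Function.update (Function.update p f₃ 0) f₂ 0) f₁ 0) (TEvent ends a₂ u c) +
      (1 - p f₁) * (1 - p f₂) * (1 - p f₃) * prob (Function.update (Function.update (Function.update p f₃ 0) f₂ 0) f₁ 0) (TEvent ends a₂ u c) := by
  have hsymm : ∀ (ω : Config E) (v w : V), Conn ends ω v w ↔ Conn ends ω w v :=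
    fun ω v w => ⟨conn_symm, conn_symm⟩
  rw [prob_three_coins p _ f₁ f₂ f₃]
  have e111 : {ω : Config E | Function.update (Function.update (Function.update ω f₃ true) f₂ true) f₁ true ∈ TEvent ends a₂ u c} = ∅ := by
    ext ω
    simp only [Set.mem_setOf_eq, Set.mem_inter_iff, Set.mem_compl_iff, mem_connEvent, TEvent, Set.mem_empty_iff_false, Merge.conn_star_iff hf₁ hf₂ hf₃ hstar h12 h13 h23 ω true true true, hub, ha2b, hcb, ne_eq, not_false_eq_true, conn_refl, true_and, and_true, true_or, or_true, not_true_eq_false, not_false_eq_true, hsymm]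
  have e110 : {ω : Config E | Function.update (Function.update (Function.update ω f₃ false) f₂ true) f₁ true ∈ TEvent ends a₂ u c} = ∅ := by
    ext ω
    simp only [Set.mem_setOf_eq, Set.mem_inter_iff, Set.mem_compl_iff, mem_connEvent, TEvent, Set.mem_empty_iff_false, Merge.conn_star_iff hf₁ hf₂ hf₃ hstar h12 h13 h23 ω true true false, hub, ha2b, hcb, ne_eq, not_false_eq_true, conn_refl, true_and, false_and, and_true, or_false, true_or, or_true, Bool.false_eq_true, not_true_eq_false, not_false_eq_true, hsymm]
  have e101 : {ω : Config E | Function.update (Function.update (Function.update ω f₃ true) f₂ false) f₁ true ∈ TEvent ends a₂ u c} = ∅ := by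
    ext ω
    simp only [Set.mem_setOf_eq, Set.mem_inter_iff, Set.mem_compl_iff, mem_connEvent, TEvent, Set.mem_empty_iff_false, Merge.conn_star_iff hf₁ hf₂ hf₃ hstar h12 h13 h23 ω true false true, hub, ha2b, hcb, ne_eq, not_false_eq_true, conn_refl, true_and, false_and, and_true, false_or, true_or, or_true, Bool.false_eq_true, not_false_eq_true, iff_false, hsymm]
    tauto
  have e100 : {ω : Config E | Function.update (Function.update (Function.update ω f₃ false) f₂ false) f₁ true ∈ TEvent ends a₂ u c} = {ω : Config E | Function.update (Function.update (Function.update ω f₃ false) f₂ false) f₁ false ∈ TEvent ends a₂ u c} := by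
    ext ω
    simp only [Set.mem_setOf_eq, Set.mem_inter_iff, Set.mem_compl_iff, mem_connEvent, TEvent, Merge.conn_star_100_iff hf₁ hf₂ hf₃ hstar h12 h13 h23 ω, hub, ha2b, hcb, ne_eq, not_false_eq_true, not_false_eq_true]
  have e011 : {ω : Config E | Function.update (Function.update (Function.update ω f₃ true) f₂ true) f₁ false ∈ TEvent ends a₂ u c} = {ω : Config E | Function.update (Function.update (Function.update ω f₃ false) f₂ false) f₁ false ∈ avoidAll ends a₂ {u} ∩ (connEvent ends a₂ c)ᶜ} := by
    ext ω
    simp only [Set.mem_setOf_eq, Set.mem_inter_iff, Set.mem_compl_iff, mem_connEvent, mem_avoidAll, Finset.mem_singleton, forall_eq, TEvent, Merge.conn_star_iff hf₁ hf₂ hf₃ hstar h12 h13 h23 ω false true true, hub, ha2b, hcb, ne_eq, not_false_eq_true, conn_refl, true_and, false_and, and_true, false_or, true_or, or_true, Bool.false_eq_true, not_false_eq_true, hsymm]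
    tauto
  have e010 : {ω : Config E | Function.update (Function.update (Function.update ω f₃ false) f₂ true) f₁ false ∈ TEvent ends a₂ u c} = {ω : Config E | Function.update (Function.update (Function.update ω f₃ false) f₂ false) f₁ false ∈ TEvent ends a₂ u c} := by
    ext ω
    simp only [Set.mem_setOf_eq, Set.mem_inter_iff, Set.mem_compl_iff, mem_connEvent, TEvent, Merge.conn_star_010_iff hf₁ hf₂ hf₃ hstar h12 h13 h23 ω, hub, ha2b, hcb, ne_eq, not_false_eq_true, not_false_eq_true]
  have e001 : {ω : Config E | Function.update (Function.update (Function.update ω f₃ true) f₂ false) f₁ false ∈ TEvent ends a₂ u c} = {ω : Config E | Function.update (Function.update (Function.update ω f₃ false) f₂ false) f₁ false ∈ TEvent ends a₂ u c} := by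
    ext ω
    simp only [Set.mem_setOf_eq, Set.mem_inter_iff, Set.mem_compl_iff, mem_connEvent, TEvent, Merge.conn_star_001_iff hf₁ hf₂ hf₃ hstar h12 h13 h23 ω, hub, ha2b, hcb, ne_eq, not_false_eq_true, not_false_eq_true]
  rw [e111, e110, e101, e100, e011, e010, e001]
  simp only [prob_empty, ← prob_pinned_eq]
  ring


/-- Table entry `hb`: `P(connEvent ends a₂ b)` in the coin worlds. -/
theorem table_hb (p : E → R) (ends : E → Sym2 V) (u a₂ c b : V) (f₁ f₂ f₃ : E)
    (hf₁ : ends f₁ = s(b, a₂)) (hf₂ : ends f₂ = s(b, u)) (hf₃ : ends f₃ = s(b, c))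
    (hstar : ∀ e, (∃ y, ends e = s(b, y)) → e = f₁ ∨ e = f₂ ∨ e = f₃)
    (h12 : f₁ ≠ f₂) (h13 : f₁ ≠ f₃) (h23 : f₂ ≠ f₃) (ha2b : a₂ ≠ b) :
    prob p (connEvent ends a₂ b) =
      p f₁ * p f₂ * p f₃ * prob (Function.update (Function.update (Function.update p f₃ 0) f₂ 0) f₁ 0) (Set.univ) +
      p f₁ * p f₂ * (1 - p f₃) * prob (Function.update (Function.update (Function.update p f₃ 0) f₂ 0) f₁ 0) (Set.univ) +
      p f₁ * (1 - p f₂) * p f₃ * prob (Function.update (Function.update (Function.update p f₃ 0) f₂ 0) f₁ 0) (Set.univ) +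
      p f₁ * (1 - p f₂) * (1 - p f₃) * prob (Function.update (Function.update (Function.update p f₃ 0) f₂ 0) f₁ 0) (Set.univ) +
      (1 - p f₁) * p f₂ * p f₃ * prob (Function.update (Function.update (Function.update p f₃ 0) f₂ 0) f₁ 0) (connEvent ends u a₂ ∪ connEvent ends a₂ c) +
      (1 - p f₁) * p f₂ * (1 - p f₃) * prob (Function.update (Function.update (Function.update p f₃ 0) f₂ 0) f₁ 0) (connEvent ends u a₂) +
      (1 - p f₁) * (1 - p f₂) * p f₃ * prob (Function.update (Function.update (Function.update p f₃ 0) f₂ 0) f₁ 0) (connEvent ends a₂ c) := by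
  have hsymm : ∀ (ω : Config E) (v w : V), Conn ends ω v w ↔ Conn ends ω w v :=
    fun ω v w => ⟨conn_symm, conn_symm⟩
  rw [prob_three_coins p _ f₁ f₂ f₃]
  have e111 : {ω : Config E | Function.update (Function.update (Function.update ω f₃ true) f₂ true) f₁ true ∈ connEvent ends a₂ b} = {ω : Config E | Function.update (Function.update (Function.update ω f₃ false) f₂ false) f₁ false ∈ Set.univ} := by
    ext ω
    simp only [Set.mem_setOf_eq, mem_connEvent, Set.mem_univ, Merge.conn_star_b_iff hf₁ hf₂ hf₃ hstar h12 h13 h23 ω true true true, ha2b, ne_eq, not_false_eq_true, conn_refl, true_and, and_true, true_or, not_false_eq_true, hsymm]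
  have e110 : {ω : Config E | Function.update (Function.update (Function.update ω f₃ false) f₂ true) f₁ true ∈ connEvent ends a₂ b} = {ω : Config E | Function.update (Function.update (Function.update ω f₃ false) f₂ false) f₁ false ∈ Set.univ} := by
    ext ω
    simp only [Set.mem_setOf_eq, mem_connEvent, Set.mem_univ, Merge.conn_star_b_iff hf₁ hf₂ hf₃ hstar h12 h13 h23 ω true true false, ha2b, ne_eq, not_false_eq_true, conn_refl, true_and, false_and, and_true, or_false, true_or, Bool.false_eq_true, not_false_eq_true, hsymm]
  have e101 : {ω : Config E | Function.update (Function.update (Function.update ω f₃ true) f₂ false) f₁ true ∈ connEvent ends a₂ b} = {ω : Config E | Function.update (Function.update (Function.update ω f₃ false) f₂ false) f₁ false ∈ Set.univ} := by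
    ext ω
    simp only [Set.mem_setOf_eq, mem_connEvent, Set.mem_univ, Merge.conn_star_b_iff hf₁ hf₂ hf₃ hstar h12 h13 h23 ω true false true, ha2b, ne_eq, not_false_eq_true, conn_refl, true_and, false_and, and_true, false_or, true_or, Bool.false_eq_true, not_false_eq_true, hsymm]
  have e100 : {ω : Config E | Function.update (Function.update (Function.update ω f₃ false) f₂ false) f₁ true ∈ connEvent ends a₂ b} = {ω : Config E | Function.update (Function.update (Function.update ω f₃ false) f₂ false) f₁ false ∈ Set.univ} := by
    ext ω
    simp only [Set.mem_setOf_eq, mem_connEvent, Set.mem_univ, Merge.conn_star_b_iff hf₁ hf₂ hf₃ hstar h12 h13 h23 ω true false false, ha2b, ne_eq, not_false_eq_true, conn_refl, false_and, and_true, or_false, Bool.false_eq_true, not_false_eq_true, hsymm]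
  have e011 : {ω : Config E | Function.update (Function.update (Function.update ω f₃ true) f₂ true) f₁ false ∈ connEvent ends a₂ b} = {ω : Config E | Function.update (Function.update (Function.update ω f₃ false) f₂ false) f₁ false ∈ connEvent ends u a₂ ∪ connEvent ends a₂ c} := by
    ext ω
    simp only [Set.mem_setOf_eq, Set.mem_union, mem_connEvent, Merge.conn_star_b_iff hf₁ hf₂ hf₃ hstar h12 h13 h23 ω false true true, ha2b, ne_eq, not_false_eq_true, conn_refl, true_and, and_true, false_or, Bool.false_eq_true, not_false_eq_true, hsymm]
  have e010 : {ω : Config E | Function.update (Function.update (Function.update ω f₃ false) f₂ true) f₁ false ∈ connEvent ends a₂ b} = {ω : Config E | Function.update (Function.update (Function.update ω f₃ false) f₂ false) f₁ false ∈ connEvent ends u a₂} := by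
    ext ω
    simp only [Set.mem_setOf_eq, mem_connEvent, Merge.conn_star_b_iff hf₁ hf₂ hf₃ hstar h12 h13 h23 ω false true false, ha2b, ne_eq, not_false_eq_true, conn_refl, true_and, false_and, and_true, or_false, false_or, Bool.false_eq_true, not_false_eq_true, hsymm]
  have e001 : {ω : Config E | Function.update (Function.update (Function.update ω f₃ true) f₂ false) f₁ false ∈ connEvent ends a₂ b} = {ω : Config E | Function.update (Function.update (Function.update ω f₃ false) f₂ false) f₁ false ∈ connEvent ends a₂ c} := by
    ext ω
    simp only [Set.mem_setOf_eq, mem_connEvent, Merge.conn_star_b_iff hf₁ hf₂ hf₃ hstar h12 h13 h23 ω false false true, ha2b, ne_eq, not_false_eq_true, conn_refl, true_and, false_and, and_true, false_or, Bool.false_eq_true, not_false_eq_true, hsymm]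
  have e000 : {ω : Config E | Function.update (Function.update (Function.update ω f₃ false) f₂ false) f₁ false ∈ connEvent ends a₂ b} = ∅ := by
    ext ω
    simp only [Set.mem_setOf_eq, mem_connEvent, Set.mem_empty_iff_false, Merge.conn_star_b_iff hf₁ hf₂ hf₃ hstar h12 h13 h23 ω false false false, ha2b, ne_eq, not_false_eq_true, conn_refl, false_and, and_true, or_false, Bool.false_eq_true, not_false_eq_true, hsymm]
  rw [e111, e110, e101, e100, e011, e010, e001, e000]
  simp only [prob_empty, ← prob_pinned_eq]
  ring


/-- Table entry `d0`: `P(avoidAll ends a₂ {c})` in the coin worlds. -/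
theorem table_d0 (p : E → R) (ends : E → Sym2 V) (u a₂ c b : V) (f₁ f₂ f₃ : E)
    (hf₁ : ends f₁ = s(b, a₂)) (hf₂ : ends f₂ = s(b, u)) (hf₃ : ends f₃ = s(b, c))
    (hstar : ∀ e, (∃ y, ends e = s(b, y)) → e = f₁ ∨ e = f₂ ∨ e = f₃)
    (h12 : f₁ ≠ f₂) (h13 : f₁ ≠ f₃) (h23 : f₂ ≠ f₃) (ha2b : a₂ ≠ b) (hcb : c ≠ b) :
    prob p (avoidAll ends a₂ {c}) =
      p f₁ * p f₂ * (1 - p f₃) * prob (Function.update (Function.update (Function.update p f₃ 0) f₂ 0) f₁ 0) (avoidAll ends a₂ {c} ∩ (connEvent ends u c)ᶜ) +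
      p f₁ * (1 - p f₂) * (1 - p f₃) * prob (Function.update (Function.update (Function.update p f₃ 0) f₂ 0) f₁ 0) (avoidAll ends a₂ {c}) +
      (1 - p f₁) * p f₂ * p f₃ * prob (Function.update (Function.update (Function.update p f₃ 0) f₂ 0) f₁ 0) (avoidAll ends a₂ {u} ∩ (connEvent ends a₂ c)ᶜ) +
      (1 - p f₁) * p f₂ * (1 - p f₃) * prob (Function.update (Function.update (Function.update p f₃ 0) f₂ 0) f₁ 0) (avoidAll ends a₂ {c}) +
      (1 - p f₁) * (1 - p f₂) * p f₃ * prob (Function.update (Function.update (Function.update p f₃ 0) f₂ 0) f₁ 0) (avoidAll ends a₂ {c}) +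
      (1 - p f₁) * (1 - p f₂) * (1 - p f₃) * prob (Function.update (Function.update (Function.update p f₃ 0) f₂ 0) f₁ 0) (avoidAll ends a₂ {c}) := by
  have hsymm : ∀ (ω : Config E) (v w : V), Conn ends ω v w ↔ Conn ends ω w v :=
    fun ω v w => ⟨conn_symm, conn_symm⟩
  rw [prob_three_coins p _ f₁ f₂ f₃]
  have e111 : {ω : Config E | Function.update (Function.update (Function.update ω f₃ true) f₂ true) f₁ true ∈ avoidAll ends a₂ {c}} = ∅ := by
    ext ω
    simp only [Set.mem_setOf_eq, mem_avoidAll, Finset.mem_singleton, forall_eq, Set.mem_empty_iff_false, Merge.conn_star_iff hf₁ hf₂ hf₃ hstar h12 h13 h23 ω true true true, ha2b, hcb, ne_eq, not_false_eq_true, conn_refl, true_and, and_true, true_or, or_true, not_true_eq_false, not_false_eq_true, hsymm]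
  have e110 : {ω : Config E | Function.update (Function.update (Function.update ω f₃ false) f₂ true) f₁ true ∈ avoidAll ends a₂ {c}} = {ω : Config E | Function.update (Function.update (Function.update ω f₃ false) f₂ false) f₁ false ∈ avoidAll ends a₂ {c} ∩ (connEvent ends u c)ᶜ} := by
    ext ω
    simp only [Set.mem_setOf_eq, Set.mem_inter_iff, Set.mem_compl_iff, mem_connEvent, mem_avoidAll, Finset.mem_singleton, forall_eq, Merge.conn_star_iff hf₁ hf₂ hf₃ hstar h12 h13 h23 ω true true false, ha2b, hcb, ne_eq, not_false_eq_true, conn_refl, true_and, false_and, and_true, or_false, true_or, Bool.false_eq_true, not_false_eq_true, hsymm]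
    tauto
  have e101 : {ω : Config E | Function.update (Function.update (Function.update ω f₃ true) f₂ false) f₁ true ∈ avoidAll ends a₂ {c}} = ∅ := by
    ext ω
    simp only [Set.mem_setOf_eq, mem_avoidAll, Finset.mem_singleton, forall_eq, Set.mem_empty_iff_false, Merge.conn_star_iff hf₁ hf₂ hf₃ hstar h12 h13 h23 ω true false true, ha2b, hcb, ne_eq, not_false_eq_true, conn_refl, true_and, false_and, and_true, false_or, true_or, or_true, Bool.false_eq_true, not_true_eq_false, not_false_eq_true, hsymm]
  have e100 : {ω : Config E | Function.update (Function.update (Function.update ω f₃ false) f₂ false) f₁ true ∈ avoidAll ends a₂ {c}} = {ω : Config E | Function.update (Function.update (Function.update ω f₃ false) f₂ false) f₁ false ∈ avoidAll ends a₂ {c}} := by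
    ext ω
    simp only [Set.mem_setOf_eq, mem_avoidAll, Finset.mem_singleton, forall_eq, Merge.conn_star_100_iff hf₁ hf₂ hf₃ hstar h12 h13 h23 ω, ha2b, hcb, ne_eq, not_false_eq_true, not_false_eq_true]
  have e011 : {ω : Config E | Function.update (Function.update (Function.update ω f₃ true) f₂ true) f₁ false ∈ avoidAll ends a₂ {c}} = {ω : Config E | Function.update (Function.update (Function.update ω f₃ false) f₂ false) f₁ false ∈ avoidAll ends a₂ {u} ∩ (connEvent ends a₂ c)ᶜ} := by
    ext ω
    simp only [Set.mem_setOf_eq, Set.mem_inter_iff, Set.mem_compl_iff, mem_connEvent, mem_avoidAll, Finset.mem_singleton, forall_eq, Merge.conn_star_iff hf₁ hf₂ hf₃ hstar h12 h13 h23 ω false true true, ha2b, hcb, ne_eq, not_false_eq_true, conn_refl, true_and, false_and, and_true, false_or, or_true, Bool.false_eq_true, not_false_eq_true, hsymm]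
    tauto
  have e010 : {ω : Config E | Function.update (Function.update (Function.update ω f₃ false) f₂ true) f₁ false ∈ avoidAll ends a₂ {c}} = {ω : Config E | Function.update (Function.update (Function.update ω f₃ false) f₂ false) f₁ false ∈ avoidAll ends a₂ {c}} := by
    ext ω
    simp only [Set.mem_setOf_eq, mem_avoidAll, Finset.mem_singleton, forall_eq, Merge.conn_star_010_iff hf₁ hf₂ hf₃ hstar h12 h13 h23 ω, ha2b, hcb, ne_eq, not_false_eq_true, not_false_eq_true]
  have e001 : {ω : Config E | Function.update (Function.update (Function.update ω f₃ true) f₂ false) f₁ false ∈ avoidAll ends a₂ {c}} = {ω : Config E | Function.update (Function.update (Function.update ω f₃ false) f₂ false) f₁ false ∈ avoidAll ends a₂ {c}} := by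
    ext ω
    simp only [Set.mem_setOf_eq, mem_avoidAll, Finset.mem_singleton, forall_eq, Merge.conn_star_001_iff hf₁ hf₂ hf₃ hstar h12 h13 h23 ω, ha2b, hcb, ne_eq, not_false_eq_true, not_false_eq_true]
  rw [e111, e110, e101, e100, e011, e010, e001]
  simp only [prob_empty, ← prob_pinned_eq]
  ring


end Coin3

end RootLeafU

end Summit.Ventures.PercRepro2
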